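import Summits.BirchSwinnertonDyer.BirchSwinnertonDyer.Theorems.KolyvaginRankRigidityAtTwoNoTwoTorsionOverK
import HarnessLib

/-!
# Crux V2 `KolyvaginCorankRigidityAtTwo` (stmt-BirchSwinnertonDyer-23949), line `kolyvagin_depth_split`:
# the OPEN stub `stub_lowerBoundMinimalPosDepth` (lower bound at MARGIN-0-minimal depth) follows from the
# RICH lower bound V2♭∞ `KolyvaginCorankLowerBoundAtTwoRich` (stmt-27984, landed modulo Gross 1991 Prop. 3.7 (2))
# plus the EXISTENCE of a rich depth on the frame (V1′∞ / U1) — margin-0 minimality is only used as `ν ≤ r*`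

Helper file (`--supports stmt-BirchSwinnertonDyer-23949`), THEOREMS ONLY (no definition, no named fact, no
`sorry`).  The registered stub `stub_lowerBoundMinimalPosDepth` asks: at a non-zero class `c_M(n) ≠ 0`
(`1 ≤ M ≤ M(n)`) whose depth `ν = #(ℓ ∣ n) ≥ 1` is minimal among ALL non-zero classes with `1 ≤ M' ≤ M(n')`
(margin `0`), `ν + 1 ≤ c ∨ ν + 1 ≤ c'` (`c, c'` the `ℤ₂`-coranks of `Sel_{2^∞}` of `E` and `E^{(d_K)}`).  The
recorded reading (lead krr2-p1, SWAP-LEDGER / MEMO-v2: «method-unreachable as typed — the prime swap at `2` is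
lossy, so margin-`0` minimality cannot seed the triangular system») concerns running Kolyvagin's induction AT
depth `ν`.  Observation proved here: one never has to.  Let `r*` be the LEAST rich depth of the frame (a depth
`r` is rich when for every `θ, k` some non-zero `(θ,k)`-strong class has depth exactly `r`; a rich depth exists
by V1′∞).  Every depth `< r*` is not rich (minimality of `r*`), so V2♭∞ applies AT `r*` and gives
`r* + 1 ≤ c ∨ r* + 1 ≤ c'`; and a rich depth carries a non-zero class with `M ≤ 1·M + 0 ≤ M(n)`, so margin-`0`
minimality of `ν` gives `ν ≤ r*`.  Hence `ν + 1 ≤ c ∨ ν + 1 ≤ c'`.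

* `lowerBound_of_rich_of_exists_richDepth` — the pointwise statement: V2♭∞ + (∃ rich depth on the frame) +
  margin-`0` minimality of `ν` ⟹ `ν + 1 ≤ c ∨ ν + 1 ≤ c'` (any `ν`, also `ν = 0`; `Nat.find`).
* `lowerBoundMinimalPosDepth_of_rich_of_strongSystem` — the registered stub's signature with ONE extra binder
  `SatisfiesHeegnerHypothesis 2 K` (2 split in `K`, the habitat clause of V1′∞), from the two ROUTE decls
  V2♭∞ `KolyvaginCorankLowerBoundAtTwoRich` and V1′∞ `KolyvaginStrongNonzeroSystemAtTwo` BY NAME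
  (`E(K)[2] = 0` from the landed `noTwoTorsionOverK_proof`; `4N ∣ β² − d_K` from the datum; `d_K` odd from
  `2 ∤ d_K`).
* (not restated here, one line from the landed `KolyvaginLowerBoundAtTwo.KolyvaginCorankLowerBoundAtTwoRich_of_prop37`
  (p641767) and `KolyvaginAtTwo.KolyvaginSwap.strongNonzeroSystem_of_boundedDefect`): the same from the print
  fact Gross 1991 Prop. 3.7 (2) and U1 `KolyvaginBoundedDefectAtTwo` (stmt-28083, OPEN) alone.

So on the 2-split sub-habitat the stub's remaining content is U1 ∧ Prop. 3.7 (2) — the SAME open statement as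
for V1′∞/V1′θ/V1′ₛ; on the 2-inert sub-habitat (`d_K ≡ 5 (8)`) it is V2♭∞'s input «some depth is rich», for
which the route has no supplier.  The same argument gives V2♭ `KolyvaginCorankLowerBoundAtTwo` (stmt-24623) from
V2♭∞ + a rich depth (not stated here: not this seat's item).  HONEST FRAMING: implications; the stub is NOT closed
(its verbatim signature has no richness hypothesis); V2, V2♭, V2♭∞'s inputs, V1′∞, U1 stay OPEN; the descent stub
`stub_upperBoundPosDepth` is untouched; BSD is NOT proved by any of this.

References (locators only): [cite: Kolyvagin1991MathAnn, §2 Thm. 2.2–2.3, (2.1), Conj. 2.5]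
[cite: McCallumLMS1991, §5 Prop. 5.2] [cite: WZhang2014, Lemma 8.4, Thm. 11.2 (i)] [cite: GrossLMS1991, Prop. 3.7 (2)].
-/

set_option autoImplicit false
-- the Theorems namespace of this sub repeats the summit name by design (D-0017 nested layout)
set_option linter.dupNamespace false

noncomputable section

open scoped Classical

open WeierstrassCurve Literature.NumberTheory.EllipticCurves
  Literature.NumberTheory.EllipticCurves.ModularForms
open Summit.BirchSwinnertonDyer.BirchSwinnertonDyer.Theses.KolyvaginRankRigidityAtTwo

namespace Summit.BirchSwinnertonDyer.BirchSwinnertonDyer.Theorems.KolyvaginRankRigidity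

/-- **Lower bound at a margin-`0`-minimal depth from the RICH lower bound and the existence of a rich depth.**
On V2♭'s habitat and a frame `(Dt, β, ι)`: if V2♭∞ holds, some depth is rich, and every non-zero class
`c_{M'}(n') ≠ 0` with `1 ≤ M' ≤ M(n')` has depth `≥ ν`, then `ν + 1 ≤ c ∨ ν + 1 ≤ c'` — apply V2♭∞ at the
least rich depth `r* ≥ ν`. [cite: Kolyvagin1991MathAnn, §2 Thm. 2.2 and (2.1)] [cite: WZhang2014, Lemma 8.4] -/
theorem lowerBound_of_rich_of_exists_richDepth (hV2 : KolyvaginCorankLowerBoundAtTwoRich)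
    (W : WeierstrassCurve ℚ) [W.IsElliptic] [W.IsGloballyMinimal] (hCM : ¬ W.HasCM)
    (hred : Rank1Residual.GoodOrd W 2 ∨ Rank1Residual.Mult W 2)
    (hsur : ∀ m : ℕ, W.HasSurjectiveModNGaloisRep (2 ^ m : ℕ))
    (K : Type) [Field K] [NumberField K] (hK : IsImaginaryQuadratic K) (hne3 : NumberField.discr K ≠ -3)
    (hne4 : NumberField.discr K ≠ -4) (h2d : ¬ ((2 : ℤ) ∣ NumberField.discr K)) [NeZero (W.conductorNorm ℤ)]
    (hHN : SatisfiesHeegnerHypothesis (W.conductorNorm ℤ) K)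
    (Dt : ModularParametrizationData W (W.conductorNorm ℤ)) (β : ℤ) (ι : K →+* ℂ)
    (hrich : ∃ r : ℕ, ∀ θ k : ℕ, ∃ (n : ℕ) (d : KolyvaginHeegnerData Dt β ι n) (M : ℕ),
      KolyvaginDescent.KolSupp (Zhang2014.IsKolyvaginPrime (W.conductorNorm ℤ) W K 2) n ∧
        n.primeFactors.card = r ∧ 1 ≤ M ∧ ((θ * M + k : ℕ) : ℕ∞) ≤ Zhang2014.levelIndex W 2 n ∧
        d.kolyvaginClass Nat.prime_two M ≠ 0)
    (ν : ℕ)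
    (hmin : ∀ (n' : ℕ) (d' : KolyvaginHeegnerData Dt β ι n') (M' : ℕ),
      KolyvaginDescent.KolSupp (Zhang2014.IsKolyvaginPrime (W.conductorNorm ℤ) W K 2) n' → 1 ≤ M' →
        (M' : ℕ∞) ≤ Zhang2014.levelIndex W 2 n' → d'.kolyvaginClass Nat.prime_two M' ≠ 0 →
        ν ≤ n'.primeFactors.card) :
    ν + 1 ≤ W.selmerCorank 2 ∨ ν + 1 ≤ (W.quadraticTwist (NumberField.discr K : ℚ)).selmerCorank 2 := by
  classical
  -- the least rich depth `r*`
  have hR : ∀ θ k : ℕ, ∃ (n : ℕ) (d : KolyvaginHeegnerData Dt β ι n) (M : ℕ),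
      KolyvaginDescent.KolSupp (Zhang2014.IsKolyvaginPrime (W.conductorNorm ℤ) W K 2) n ∧
        n.primeFactors.card = Nat.find hrich ∧ 1 ≤ M ∧
        ((θ * M + k : ℕ) : ℕ∞) ≤ Zhang2014.levelIndex W 2 n ∧ d.kolyvaginClass Nat.prime_two M ≠ 0 :=
    Nat.find_spec hrich
  -- every smaller depth is not rich
  have hbelow : ∀ ν' : ℕ, ν' < Nat.find hrich → ∃ θ k : ℕ, ∀ (n' : ℕ) (d' : KolyvaginHeegnerData Dt β ι n')
      (M' : ℕ), KolyvaginDescent.KolSupp (Zhang2014.IsKolyvaginPrime (W.conductorNorm ℤ) W K 2) n' →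
      1 ≤ M' → ((θ * M' + k : ℕ) : ℕ∞) ≤ Zhang2014.levelIndex W 2 n' → n'.primeFactors.card = ν' →
      d'.kolyvaginClass Nat.prime_two M' = 0 := by
    intro ν' hν'
    have hnot := Nat.find_min hrich hν'
    by_contra hcon
    refine hnot fun θ k ↦ ?_
    by_contra hθk
    refine hcon ⟨θ, k, fun n' d' M' hn' hM1' hle' hcard ↦ ?_⟩
    by_contra hne'
    exact hθk ⟨n', d', M', hn', hcard, hM1', hle', hne'⟩
  -- V2♭∞ at `r*`
  have hV := hV2 W hCM hred hsur K hK hne3 hne4 h2d hHN Dt β ι (Nat.find hrich) hR hbelow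
  -- `ν ≤ r*`: a rich depth carries a non-zero class with `M ≤ 1 · M + 0 ≤ M(n)`
  have hνr : ν ≤ Nat.find hrich := by
    obtain ⟨n, d, M, hn, hcard, hM1, hle, hne⟩ := hR 1 0
    have hMle : (M : ℕ∞) ≤ Zhang2014.levelIndex W 2 n := by simpa only [one_mul, add_zero] using hle
    exact hcard ▸ hmin n d M hn hM1 hMle hne
  rcases hV with h | h
  · exact Or.inl (le_trans (Nat.succ_le_succ hνr) h)
  · exact Or.inr (le_trans (Nat.succ_le_succ hνr) h)

/-- **`stub_lowerBoundMinimalPosDepth` on the 2-SPLIT sub-habitat from V2♭∞ and V1′∞ BY NAME.** The registered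
stub's signature (crux V2, stmt-23949, skeleton `kolyvagin_depth_split`) with one extra binder
`SatisfiesHeegnerHypothesis 2 K` (V1′∞'s habitat clause), concluded from the ROUTE decls
`KolyvaginCorankLowerBoundAtTwoRich` (stmt-27984) and `KolyvaginStrongNonzeroSystemAtTwo` (stmt-27983):
V1′∞ supplies a rich depth on the frame (`E(K)[2] = 0` by `noTwoTorsionOverK_proof`, `4N ∣ β² − d_K` from the
datum), then `lowerBound_of_rich_of_exists_richDepth`. Both hypotheses OPEN; closes nothing.
[cite: Kolyvagin1991MathAnn, §2 Thm. 2.2, (2.1)] [cite: WZhang2014, Lemma 8.4, Thm. 11.2 (i)] -/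
theorem lowerBoundMinimalPosDepth_of_rich_of_strongSystem (hV2 : KolyvaginCorankLowerBoundAtTwoRich)
    (hV1 : KolyvaginStrongNonzeroSystemAtTwo) :
    ∀ (W : WeierstrassCurve ℚ) [W.IsElliptic] [W.IsGloballyMinimal], ¬ W.HasCM →
      (Rank1Residual.GoodOrd W 2 ∨ Rank1Residual.Mult W 2) →
      (∀ m : ℕ, W.HasSurjectiveModNGaloisRep (2 ^ m : ℕ)) →
      ∀ (K : Type) [Field K] [NumberField K], IsImaginaryQuadratic K → NumberField.discr K ≠ -3 →
      NumberField.discr K ≠ -4 → ¬ ((2 : ℤ) ∣ NumberField.discr K) → ∀ [NeZero (W.conductorNorm ℤ)],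
      SatisfiesHeegnerHypothesis (W.conductorNorm ℤ) K → SatisfiesHeegnerHypothesis 2 K →
      ∀ (Dt : ModularParametrizationData W (W.conductorNorm ℤ)) (β : ℤ) (ι : K →+* ℂ) (n : ℕ)
        (d : KolyvaginHeegnerData Dt β ι n) (M : ℕ),
        KolyvaginDescent.KolSupp (Zhang2014.IsKolyvaginPrime (W.conductorNorm ℤ) W K 2) n →
        1 ≤ M → (M : ℕ∞) ≤ Zhang2014.levelIndex W 2 n → d.kolyvaginClass Nat.prime_two M ≠ 0 →
        (∀ (n' : ℕ) (d' : KolyvaginHeegnerData Dt β ι n') (M' : ℕ),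
          KolyvaginDescent.KolSupp (Zhang2014.IsKolyvaginPrime (W.conductorNorm ℤ) W K 2) n' →
          1 ≤ M' → (M' : ℕ∞) ≤ Zhang2014.levelIndex W 2 n' → d'.kolyvaginClass Nat.prime_two M' ≠ 0 →
          n.primeFactors.card ≤ n'.primeFactors.card) →
        1 ≤ n.primeFactors.card →
        (n.primeFactors.card + 1 ≤ W.selmerCorank 2 ∨
          n.primeFactors.card + 1 ≤ (W.quadraticTwist (NumberField.discr K : ℚ)).selmerCorank 2) := by
  intro W _ _ hCM hred hsur K _ _ hK hne3 hne4 h2d _ hHN hH2 Dt β ι n d M _ _ _ _ hmin _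
  have hodd : Odd (NumberField.discr K) :=
    Int.not_even_iff_odd.mp fun h ↦ h2d (even_iff_two_dvd.mp h)
  have htor : AddSubgroup.torsionBy (W.baseChange K).toAffine.Point (2 : ℤ) = ⊥ :=
    noTwoTorsionOverK_proof W hsur K hK
  have hβ : (4 * (W.conductorNorm ℤ : ℤ)) ∣ β ^ 2 - NumberField.discr K := by exact_mod_cast d.dvd_sq_sub
  exact lowerBound_of_rich_of_exists_richDepth hV2 W hCM hred hsur K hK hne3 hne4 h2d hHN Dt β ι
    (hV1 W hCM hred hsur K hK hHN hodd hne3 htor hH2 Dt β ι hβ) n.primeFactors.card hmin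

end Summit.BirchSwinnertonDyer.BirchSwinnertonDyer.Theorems.KolyvaginRankRigidity

end
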